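/-
Copyright (c) 2026 the pub-hodgecm-mathlib formalisation cell (harness21).  Prover seat hodgecm-mathlib-K2Liu-p06 (g3): Track B «K2-LIT»,
hLiu418 = stmt-HodgeConjecture-24832, LEAD F0P6-plan (g12) word 2026-09-04T06:51:40Z «= GO (X1)+(X2) NOW» (B2c Bruhat exhaustion): step (X2); 2026-09-04.
-/
import Summits.HodgeConjecture.HodgeConjecture.Theorems.K2LiuSiegelDoubledRationalPoints     -- ★ `mem_ratH_of_coe_eq_map`, `gramRL_facts`, `map_cstar`
import Summits.HodgeConjecture.HodgeConjecture.Theorems.K2LiuSiegelBruhatMiddleCellDelta    -- ★ B2b `frame_iotaGG_one`, `iotaGG_one_mem_ratH`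
import HarnessLib

/-!
# Crux `HLiu418`, ROAD Φ ∕ organ O41.1 B2c (Bruhat exhaustion), step (X2): RATIONAL FRAMES —
# rationality of `h ∈ H(𝔸)` read on `blk h`, rational sign involutions `w_χ = ι(1, diag(1 − 2χ))`, rational Levi elements with prescribed frame blocks

Cell `hodgecm-mathlib`, crux item hLiu418 = `stmt-HodgeConjecture-24832`, route `HCCMUnconditional`; squad K2 ∕ K2Liu, LEAD F0P6-plan (g12), prover K2Liu-p06 (g3).
THEOREMS ONLY (imports ★ `K2LiuSiegelDoubledRationalPoints`, ★ B2b `K2LiuSiegelBruhatMiddleCellDelta`; no `def`, no instance, no notation, no `sorry`,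
default heartbeats); lane `--supports stmt-HodgeConjecture-24832 --as helper` (count-neutral).

WHAT.  The bookkeeping the pointwise exhaustion face (X) (sequel `K2LiuSiegelBruhatMiddleCellExhaustion`) transports through:
* §1 **`exists_blk_eq_map_of_mem_ratH`** ∕ **`mem_ratH_of_blk_eq_map`**: `h ∈ H(L⁺) ⟺ blk h = M₀ ⊗ 1` for some `M₀ ∈ M_{2n}(L)` (⇐: `M₀` is unitary for
  `T_L ⊕ −T_L` because `L → 𝔸_L` is injective on matrices, and invertible with inverse `Φ⁻¹ M₀^* Φ`; ★ `mem_ratH_of_coe_eq_map`).  This subsumes ★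
  `mem_ratH_of_blk_eq_levi_map` ∕ `…_unip_map`.  `frame_map` (`E₁ (M₀ ⊗ 1) E₂ = (E₁ M₀ E₂) ⊗ 1`).
* §2 **`exists_signInvolution`**: for a `0∕1` pattern `χ` on `Fin N × Fin M`, `γ_χ := diag(1 − 2χ) ∈ G₁(L⁺)` (matrix `diag(±1)`) with `γ_χ² = 1` (★ B2c-i
  `exists_signPair` is the one-point pattern); `reindex_signInvolution` (`G = reindex e (γ_χ ⊗ 1) = 1 − 2·diag(χ ∘ e⁻¹ ⊗ 1)`), so the frame of
  `w_χ = ι(1, γ_χ ⊗ 1)` is `W_E = (1 0; −2E, 1 − 2E)`, `E = diag(χ ⊗ 1)` (★ B2b `frame_iotaGG_one`): `frame_iotaGG_signInvolution`.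
* §3 `frame_levi` (`E₁ · m(A, D) · E₂ = (A, ⅟2(A − D); 0, D)` for the Cayley–Levi matrix `m(A,D) = R diag(A,D) R⁻¹` of ★ `K2LiuSiegelDoubledLeviMatrix`),
  **`exists_rat_siegel_frame₁₁`** ∕ **`exists_rat_siegel_frame₂₂`**: for `a₀ ∈ GL_n(L)` (resp. `d₀`) a RATIONAL `m ∈ P_Δ(L⁺)` whose frame is `(a₀ ⊗ 1, *; 0, *)`
  (resp. `(*, *; 0, d₀ ⊗ 1)`) — ★ `exists_levi` + ★ `mem_ratH_of_blk_eq_levi_map` + the involution `A ↦ T⁻¹ σ(A⁻¹)ᵀ T`.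
[GelbartPiatetskishapiroRallis1987, Part A §1], [HarrisKudlaSweet1996, §1 (1.11)–(1.12)], [MoeglinWaldspurger1995, II.1.7].

HONEST LABEL.  Count-neutral helper; `HC_CM` is proved only modulo the 7 printed citations (2 remaining named inputs: hLiu418 = `stmt-HodgeConjecture-24832`,
h413 = `stmt-HodgeConjecture-24833`) until rung 0 closes.
-/

set_option autoImplicit false
set_option linter.dupNamespace false -- the mandated namespace repeats `HodgeConjecture.HodgeConjecture`

noncomputable section

open scoped Matrix Kronecker
open NumberField IsDedekindDomain
open Literature.NumberTheory.Automorphic Literature.NumberTheory.Automorphic.UnitaryGroup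
open Literature.NumberTheory.GelbartRogawski1991 Literature.NumberTheory.GelbartRogawski1991.GRConstruction
open Literature.NumberTheory.GelbartRogawski1991.AdaptedBlocks
open Literature.NumberTheory.K2Lit.SiegelDoubled
open UnitaryDualPair

namespace Summit.HodgeConjecture.HodgeConjecture.Cruxes.HLiu418.K2LiuSiegelDoubledRationalFrames

open K2LiuSiegelDoubledBlkUnitary K2LiuSiegelDoubledRationalPoints K2LiuSiegelDoubledLeviMatrix K2LiuSiegelDoubledLeviAlgebra
open K2LiuSiegelBruhatMiddleCellDelta

/-! ## §0 Frame algebra over a ring -/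

section Ring

variable {R S : Type*} [CommRing R] [CommRing S] {ι : Type*} [Fintype ι] [DecidableEq ι] (f : R →+* S)

/-- `E₁ (M ⊗ 1) E₂ = (E₁ M E₂) ⊗ 1`: the triangular frame commutes with ring homomorphisms (`E₁, E₂` have entries `0, ±1`). [folklore] -/
theorem frame_map (M : Matrix (ι ⊕ ι) (ι ⊕ ι) R) :
    Matrix.fromBlocks (1 : Matrix ι ι S) 0 (-1) 1 * M.map f * Matrix.fromBlocks 1 0 1 1 =
      (Matrix.fromBlocks (1 : Matrix ι ι R) 0 (-1) 1 * M * Matrix.fromBlocks 1 0 1 1).map f := by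
  rw [Matrix.map_mul, Matrix.map_mul, Matrix.fromBlocks_map, Matrix.fromBlocks_map, Matrix.map_one f (map_zero f) (map_one f),
    Matrix.map_zero f (map_zero f), Matrix.map_neg _ (map_neg f), Matrix.map_one f (map_zero f) (map_one f)]

/-- **the frame of the Cayley–Levi matrix**: `E₁ · (R diag(A, D) R⁻¹) · E₂ = (A, ⅟2(A − D); 0, D)`. [cite: HarrisKudlaSweet1996, §1 (1.11)] -/
theorem frame_levi [Invertible (2 : R)] (A D : Matrix ι ι R) :
    Matrix.fromBlocks (1 : Matrix ι ι R) 0 (-1) 1 * (cayR R ι * Matrix.fromBlocks A 0 0 D * cayRinv R ι) * Matrix.fromBlocks 1 0 1 1 =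
      Matrix.fromBlocks A ((⅟ (2 : R)) • (A - D)) 0 D := by
  rw [cayRinv, cayR, Matrix.mul_smul, Matrix.mul_smul, Matrix.smul_mul, Matrix.fromBlocks_multiply, Matrix.fromBlocks_multiply,
    Matrix.fromBlocks_multiply, Matrix.fromBlocks_multiply, Matrix.fromBlocks_smul, Matrix.fromBlocks_inj]
  simp only [Matrix.one_mul, Matrix.mul_one, Matrix.zero_mul, Matrix.mul_zero, add_zero, zero_add, Matrix.neg_mul, Matrix.mul_neg,
    smul_add, smul_neg, smul_sub, neg_neg]
  have key : ∀ Z : Matrix ι ι R, (⅟ (2 : R)) • Z + (⅟ (2 : R)) • Z = Z := fun Z => by rw [← add_smul, invOf_two_add_invOf_two, one_smul]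
  refine ⟨?_, (sub_eq_add_neg _ _).symm, by abel, ?_⟩
  · calc _ = (⅟ (2 : R)) • A + (⅟ (2 : R)) • A := by abel
      _ = A := key A
  · calc _ = (⅟ (2 : R)) • D + (⅟ (2 : R)) • D := by abel
      _ = D := key D

/-- **the Levi duality `A ↦ T⁻¹ σ(A)ᵀ T` is an involution up to inversion**: `T⁻¹ σ(T⁻¹ σ(d)ᵀ T)ᵀ T = d` (`T` symmetric, `σ`-fixed, invertible;
`σ` an involution). [cite: HarrisKudlaSweet1996, §1 (1.11)] -/
theorem leviD_leviD {σ : R →+* R} {T : Matrix ι ι R} (hT : IsUnit T.det) (hTσ : T.map σ = T) (hTt : Tᵀ = T) (hσ : ∀ x, σ (σ x) = x)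
    (d : Matrix ι ι R) : T⁻¹ * ((T⁻¹ * (d.map σ)ᵀ * T).map σ)ᵀ * T = d := by
  have h1 : ((T⁻¹ * (d.map σ)ᵀ * T).map σ)ᵀ = T * d * T⁻¹ := by
    rw [Matrix.map_mul, Matrix.map_mul, map_nonsing_inv_eq hT hTσ, hTσ, Matrix.transpose_map, map_map_of_involutive hσ,
      Matrix.transpose_mul, Matrix.transpose_mul, Matrix.transpose_transpose, hTt, Matrix.transpose_nonsing_inv, hTt,
      Matrix.mul_assoc]
  rw [h1]
  calc T⁻¹ * (T * d * T⁻¹) * T = (T⁻¹ * T) * d * (T⁻¹ * T) := by simp only [Matrix.mul_assoc]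
    _ = d := by rw [Matrix.nonsing_inv_mul T hT, Matrix.one_mul, Matrix.mul_one]

end Ring

section Doubled

variable (L : Type) [Field L] [NumberField L] [IsCMField L]
variable {N M n : ℕ} (e : Fin N × Fin M ≃ Fin n)
  (dV : Fin N → L) (hdV : ∀ i, IsCMField.complexConj L (dV i) = dV i)
  (dW : Fin M → L) (hdW : ∀ i, IsCMField.complexConj L (dW i) = dW i)

/-! ## §1 Rationality read on the block matrix -/

/-- **rational elements have rational block matrices**: `h ∈ H(L⁺) ⟹ blk h = M₀ ⊗ 1`, `M₀ ∈ M_{2n}(L)`. [cite: MoeglinWaldspurger1995, I.2.1] -/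
theorem exists_blk_eq_map_of_mem_ratH {q : HA L e dV hdV dW hdW} (hq : q ∈ ratH L e dV hdV dW hdW) :
    ∃ M₀ : Matrix (Fin n ⊕ Fin n) (Fin n ⊕ Fin n) L, blk L e dV hdV dW hdW q = M₀.map (algebraMap L (AdeleRing (𝓞 L) L)) := by
  obtain ⟨γ, hγ⟩ := MonoidHom.mem_range.1 hq
  refine ⟨Matrix.reindex (e₂ (n := n)).symm (e₂ (n := n)).symm ((γ : GL (Fin (n + n)) L) : Matrix (Fin (n + n)) (Fin (n + n)) L), ?_⟩
  have h1 : ((q : GL (Fin (n + n)) (AdeleRing (𝓞 L) L)) : Matrix (Fin (n + n)) (Fin (n + n)) (AdeleRing (𝓞 L) L)) =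
      ((γ : GL (Fin (n + n)) L) : Matrix (Fin (n + n)) (Fin (n + n)) L).map (algebraMap L (AdeleRing (𝓞 L) L)) := by
    rw [← hγ]; rfl
  change Matrix.reindex (e₂ (n := n)).symm (e₂ (n := n)).symm
      ((q : GL (Fin (n + n)) (AdeleRing (𝓞 L) L)) : Matrix (Fin (n + n)) (Fin (n + n)) (AdeleRing (𝓞 L) L)) = _
  rw [h1, Matrix.reindex_apply, Matrix.reindex_apply, Matrix.submatrix_map]

/-- **THE RATIONALITY CRITERION: an element of `H(𝔸)` whose block matrix is `M₀ ⊗ 1` for some `M₀ ∈ M_{2n}(L)` lies in `H(L⁺)`** — `M₀` is unitary for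
`T_L ⊕ −T_L` (the relation holds after the injective `L → 𝔸_L`, ★ `cstar_blk`) and invertible (`Φ⁻¹ M₀^* Φ` is a left, hence right, inverse), so it is
a rational point (★ `mem_ratH_of_coe_eq_map`). [cite: HarrisKudlaSweet1996, §1 (1.11)] [cite: MoeglinWaldspurger1995, I.2.1] -/
theorem mem_ratH_of_blk_eq_map (hdV0 : ∀ i, dV i ≠ 0) (hdW0 : ∀ i, dW i ≠ 0) {q : HA L e dV hdV dW hdW}
    {M₀ : Matrix (Fin n ⊕ Fin n) (Fin n ⊕ Fin n) L} (hq : blk L e dV hdV dW hdW q = M₀.map (algebraMap L (AdeleRing (𝓞 L) L))) :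
    q ∈ ratH L e dV hdV dW hdW := by
  obtain ⟨hT, -, -, hTA⟩ := gramRL_facts L e dV hdV dW hdW hdV0 hdW0
  have hfc : ∀ x, algebraMap L (AdeleRing (𝓞 L) L) (((IsCMField.complexConj L : L ≃ₐ[Fp L] L) : L →+* L) x) =
      conjAdele (Fp L) L (IsCMField.complexConj L) (algebraMap L (AdeleRing (𝓞 L) L) x) := fun x => algebraMap_conj (Fp L) L _ x
  have hinj : Function.Injective (fun A : Matrix (Fin n ⊕ Fin n) (Fin n ⊕ Fin n) L => A.map (algebraMap L (AdeleRing (𝓞 L) L))) :=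
    fun A B h => Matrix.ext fun i j => AdeleRing.algebraMap_injective (𝓞 L) L (congrFun (congrFun h i) j)
  have hΦ : (Matrix.fromBlocks ((gramR L e dV hdV dW hdW).map (algebraMap (Fp L) L)) 0 0 (-(gramR L e dV hdV dW hdW).map (algebraMap (Fp L) L))).map
      (algebraMap L (AdeleRing (𝓞 L) L)) =
      Matrix.fromBlocks ((gramR L e dV hdV dW hdW).map ((algebraMap L (AdeleRing (𝓞 L) L)).comp (algebraMap (Fp L) L))) 0 0
        (-(gramR L e dV hdV dW hdW).map ((algebraMap L (AdeleRing (𝓞 L) L)).comp (algebraMap (Fp L) L))) := by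
    rw [Matrix.fromBlocks_map, Matrix.map_zero _ (map_zero _), Matrix.map_neg _ (map_neg _), hTA]
  -- unitarity over `L`
  have hcs : (M₀.map ((IsCMField.complexConj L : L ≃ₐ[Fp L] L) : L →+* L))ᵀ *
        Matrix.fromBlocks ((gramR L e dV hdV dW hdW).map (algebraMap (Fp L) L)) 0 0 (-(gramR L e dV hdV dW hdW).map (algebraMap (Fp L) L)) * M₀ =
      Matrix.fromBlocks ((gramR L e dV hdV dW hdW).map (algebraMap (Fp L) L)) 0 0 (-(gramR L e dV hdV dW hdW).map (algebraMap (Fp L) L)) := by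
    apply hinj
    change ((M₀.map _)ᵀ * _ * M₀).map _ = (Matrix.fromBlocks _ 0 0 _).map _
    rw [Matrix.map_mul, Matrix.map_mul, map_cstar _ hfc, hΦ, ← hq]
    exact cstar_blk L e dV hdV dW hdW q
  -- invertibility over `L`
  have hΦu : IsUnit (Matrix.fromBlocks ((gramR L e dV hdV dW hdW).map (algebraMap (Fp L) L)) 0 0 (-(gramR L e dV hdV dW hdW).map (algebraMap (Fp L) L))).det := by
    rw [Matrix.det_fromBlocks_zero₂₁, Matrix.det_neg]
    exact hT.mul (((isUnit_one.neg).pow _).mul hT)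
  set M₀' : Matrix (Fin n ⊕ Fin n) (Fin n ⊕ Fin n) L :=
    (Matrix.fromBlocks ((gramR L e dV hdV dW hdW).map (algebraMap (Fp L) L)) 0 0 (-(gramR L e dV hdV dW hdW).map (algebraMap (Fp L) L)))⁻¹ *
      (M₀.map ((IsCMField.complexConj L : L ≃ₐ[Fp L] L) : L →+* L))ᵀ *
      Matrix.fromBlocks ((gramR L e dV hdV dW hdW).map (algebraMap (Fp L) L)) 0 0 (-(gramR L e dV hdV dW hdW).map (algebraMap (Fp L) L)) with hM₀'
  have h2 : M₀' * M₀ = 1 := by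
    rw [hM₀', Matrix.mul_assoc, Matrix.mul_assoc, ← Matrix.mul_assoc _ _ M₀, hcs, Matrix.nonsing_inv_mul _ hΦu]
  have h1 : M₀ * M₀' = 1 := mul_eq_one_comm.1 h2
  -- the rational point
  have hr1 : Matrix.reindex (e₂ (n := n)) (e₂ (n := n)) M₀ * Matrix.reindex (e₂ (n := n)) (e₂ (n := n)) M₀' = 1 := by
    rw [Matrix.reindex_apply, Matrix.reindex_apply, Matrix.submatrix_mul_equiv, h1, Matrix.submatrix_one_equiv]
  have hr2 : Matrix.reindex (e₂ (n := n)) (e₂ (n := n)) M₀' * Matrix.reindex (e₂ (n := n)) (e₂ (n := n)) M₀ = 1 := by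
    rw [Matrix.reindex_apply, Matrix.reindex_apply, Matrix.submatrix_mul_equiv, h2, Matrix.submatrix_one_equiv]
  set g : GL (Fin (n + n)) L := ⟨_, _, hr1, hr2⟩ with hg
  have hgmem : g ∈ UnitaryGroup.rational (Fp L) L (IsCMField.complexConj L) (n + n) (hermD L e dV hdV dW hdW) := by
    change ((Matrix.reindex (e₂ (n := n)) (e₂ (n := n)) M₀).map _)ᵀ * hermD L e dV hdV dW hdW * Matrix.reindex (e₂ (n := n)) (e₂ (n := n)) M₀ =
      hermD L e dV hdV dW hdW
    rw [hermD_eq_reindex, ← reindex_cstar, ← reindex_mul_mul, hcs]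
  refine mem_ratH_of_coe_eq_map L e dV hdV dW hdW hgmem ?_
  change ((q : GL (Fin (n + n)) (AdeleRing (𝓞 L) L)) : Matrix (Fin (n + n)) (Fin (n + n)) (AdeleRing (𝓞 L) L)) =
    (Matrix.reindex (e₂ (n := n)) (e₂ (n := n)) M₀).map (algebraMap L (AdeleRing (𝓞 L) L))
  rw [← reindex_reindex_symm ((q : GL (Fin (n + n)) (AdeleRing (𝓞 L) L)) : Matrix (Fin (n + n)) (Fin (n + n)) (AdeleRing (𝓞 L) L)),
    show Matrix.reindex (e₂ (n := n)).symm (e₂ (n := n)).symm ((q : GL (Fin (n + n)) (AdeleRing (𝓞 L) L)) :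
      Matrix (Fin (n + n)) (Fin (n + n)) (AdeleRing (𝓞 L) L)) = blk L e dV hdV dW hdW q from rfl, hq,
    Matrix.reindex_apply, Matrix.reindex_apply, ← Matrix.submatrix_map]

/-- **the frame of a rational element is rational**: `h ∈ H(L⁺) ⟹ E₁ · blk h · E₂ = F₀ ⊗ 1`. [cite: MoeglinWaldspurger1995, I.2.1] -/
theorem exists_frame_eq_map_of_mem_ratH {q : HA L e dV hdV dW hdW} (hq : q ∈ ratH L e dV hdV dW hdW) :
    ∃ F₀ : Matrix (Fin n ⊕ Fin n) (Fin n ⊕ Fin n) L,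
      Matrix.fromBlocks (1 : Matrix (Fin n) (Fin n) (AdeleRing (𝓞 L) L)) 0 (-1) 1 * blk L e dV hdV dW hdW q * Matrix.fromBlocks 1 0 1 1 =
        F₀.map (algebraMap L (AdeleRing (𝓞 L) L)) := by
  obtain ⟨M₀, hM₀⟩ := exists_blk_eq_map_of_mem_ratH L e dV hdV dW hdW hq
  exact ⟨_, by rw [hM₀, frame_map]⟩

/-- **rationality read on the frame**: `E₁ · blk h · E₂ = F₀ ⊗ 1 ⟹ h ∈ H(L⁺)` (`blk h = E₂ F₀ E₁ ⊗ 1`). [cite: MoeglinWaldspurger1995, I.2.1] -/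
theorem mem_ratH_of_frame_eq_map (hdV0 : ∀ i, dV i ≠ 0) (hdW0 : ∀ i, dW i ≠ 0) {q : HA L e dV hdV dW hdW}
    {F₀ : Matrix (Fin n ⊕ Fin n) (Fin n ⊕ Fin n) L}
    (hq : Matrix.fromBlocks (1 : Matrix (Fin n) (Fin n) (AdeleRing (𝓞 L) L)) 0 (-1) 1 * blk L e dV hdV dW hdW q * Matrix.fromBlocks 1 0 1 1 =
      F₀.map (algebraMap L (AdeleRing (𝓞 L) L))) :
    q ∈ ratH L e dV hdV dW hdW := by
  refine mem_ratH_of_blk_eq_map L e dV hdV dW hdW hdV0 hdW0 (M₀ := Matrix.fromBlocks (1 : Matrix (Fin n) (Fin n) L) 0 1 1 * F₀ * Matrix.fromBlocks 1 0 (-1) 1) ?_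
  rw [Matrix.map_mul, Matrix.map_mul, ← hq, Matrix.fromBlocks_map, Matrix.fromBlocks_map, Matrix.map_one _ (map_zero _) (map_one _),
    Matrix.map_zero _ (map_zero _), Matrix.map_neg _ (map_neg _), Matrix.map_one _ (map_zero _) (map_one _)]
  calc blk L e dV hdV dW hdW q
      = (Matrix.fromBlocks (1 : Matrix (Fin n) (Fin n) (AdeleRing (𝓞 L) L)) 0 1 1 * Matrix.fromBlocks 1 0 (-1) 1) * blk L e dV hdV dW hdW q *
          (Matrix.fromBlocks (1 : Matrix (Fin n) (Fin n) (AdeleRing (𝓞 L) L)) 0 1 1 * Matrix.fromBlocks 1 0 (-1) 1) := by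
        rw [E₂_mul_E₁, Matrix.one_mul, Matrix.mul_one]
    _ = _ := by simp only [Matrix.mul_assoc]

/-! ## §2 Rational sign involutions `γ_χ = diag(1 − 2χ) ∈ G₁(L⁺)` for a `0∕1` pattern `χ` -/

omit [NumberField L] [IsCMField L] in
/-- `diag(1 − 2χ)² = 1` for a `0∕1` pattern. [folklore] -/
theorem signDiagonal_mul_self {ι : Type*} [Fintype ι] [DecidableEq ι] {χ : ι → L} (hχ : ∀ k, χ k = 0 ∨ χ k = 1) :
    Matrix.diagonal (fun k => 1 - 2 * χ k) * Matrix.diagonal (fun k => 1 - 2 * χ k) = 1 := by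
  rw [Matrix.diagonal_mul_diagonal, ← Matrix.diagonal_one]
  congr 1
  funext k
  show (1 - 2 * χ k) * (1 - 2 * χ k) = 1
  rcases hχ k with h | h
  · rw [h]; ring
  · rw [h]; ring

/-- **the sign involution of a `0∕1` pattern is a rational point of `G₁`**: `∃ γ ∈ G₁(L⁺) = U(diag dV ⊗ diag dW)(L⁺)` with matrix `diag(1 − 2χ)`
(entries `±1`, real) and `γ² = 1`. [cite: GelbartPiatetskishapiroRallis1987, Part A §1] -/
theorem exists_signInvolution {χ : Fin N × Fin M → L} (hχ : ∀ k, χ k = 0 ∨ χ k = 1) :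
    ∃ γ : UnitaryGroup.rationalPair (Fp L) L (IsCMField.complexConj L) N M (Matrix.diagonal dV) (Matrix.diagonal dW),
      ((γ : GL (Fin N × Fin M) L) : Matrix (Fin N × Fin M) (Fin N × Fin M) L) = Matrix.diagonal (fun k => 1 - 2 * χ k) ∧ γ * γ = 1 := by
  set s : Matrix (Fin N × Fin M) (Fin N × Fin M) L := Matrix.diagonal (fun k => 1 - 2 * χ k) with hs
  have hss : s * s = 1 := signDiagonal_mul_self L hχ
  have hsmap : s.map ((IsCMField.complexConj L : L ≃ₐ[Fp L] L) : L →+* L) = s := by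
    rw [hs, Matrix.diagonal_map (map_zero _)]
    congr 1
    funext k
    show ((IsCMField.complexConj L : L ≃ₐ[Fp L] L) : L →+* L) (1 - 2 * χ k) = _
    rcases hχ k with h | h <;> simp [h]
  let g : GL (Fin N × Fin M) L := ⟨s, s, hss, hss⟩
  have hmem : g ∈ UnitaryGroup.rationalPair (Fp L) L (IsCMField.complexConj L) N M (Matrix.diagonal dV) (Matrix.diagonal dW) := by
    change g ∈ unitaryGroupOfForm _ _
    rw [mem_unitaryGroupOfForm_iff]
    change (s.map _)ᵀ * (Matrix.diagonal dV ⊗ₖ Matrix.diagonal dW) * s = Matrix.diagonal dV ⊗ₖ Matrix.diagonal dW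
    rw [hsmap, hs, Matrix.diagonal_transpose, Matrix.diagonal_kronecker_diagonal, Matrix.diagonal_mul_diagonal, Matrix.diagonal_mul_diagonal]
    congr 1
    funext k
    show (1 - 2 * χ k) * (dV k.1 * dW k.2) * (1 - 2 * χ k) = dV k.1 * dW k.2
    rcases hχ k with h' | h'
    · rw [h']; ring
    · rw [h']; ring
  exact ⟨⟨g, hmem⟩, rfl, Subtype.ext (Units.ext hss)⟩

omit [IsCMField L] in
/-- **the adelic block of `w_χ`**: for `γ` with matrix `diag(1 − 2 χ∘e)`, `G = reindex e (γ ⊗ 1) = 1 − 2·diag(χ ⊗ 1)` over `𝔸_L`. [folklore] -/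
theorem reindex_signInvolution {γ : GL (Fin N × Fin M) L} (χ : Fin n → L)
    (hγ : (γ : Matrix (Fin N × Fin M) (Fin N × Fin M) L) = Matrix.diagonal (fun k => 1 - 2 * χ (e k))) :
    Matrix.reindex e e ((γ : Matrix (Fin N × Fin M) (Fin N × Fin M) L).map (algebraMap L (AdeleRing (𝓞 L) L))) =
      1 - (2 : AdeleRing (𝓞 L) L) • Matrix.diagonal (fun i => algebraMap L (AdeleRing (𝓞 L) L) (χ i)) := by
  rw [hγ, Matrix.diagonal_map (map_zero _), Matrix.reindex_apply, Matrix.submatrix_diagonal_equiv, ← Matrix.diagonal_one, ← Matrix.diagonal_smul,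
    Matrix.diagonal_sub]
  congr 1
  funext i
  simp only [Function.comp_apply, Equiv.apply_symm_apply, Pi.smul_apply, smul_eq_mul, map_sub, map_mul, map_one, map_ofNat]

/-- **the frame of the reflection `w_χ = ι(1, γ_χ ⊗ 1)` is `W_E = (1 0; −2E, 1 − 2E)`**, `E = diag(χ ⊗ 1)` (★ B2b `frame_iotaGG_one`).
[cite: GelbartPiatetskishapiroRallis1987, Part A §1] -/
theorem frame_iotaGG_signInvolution {γ : UnitaryGroup.rationalPair (Fp L) L (IsCMField.complexConj L) N M (Matrix.diagonal dV) (Matrix.diagonal dW)}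
    (χ : Fin n → L) (hγ : ((γ : GL (Fin N × Fin M) L) : Matrix (Fin N × Fin M) (Fin N × Fin M) L) = Matrix.diagonal (fun k => 1 - 2 * χ (e k))) :
    Matrix.fromBlocks (1 : Matrix (Fin n) (Fin n) (AdeleRing (𝓞 L) L)) 0 (-1) 1 *
        blk L e dV hdV dW hdW (iotaGG L e dV hdV dW hdW
          (1, UnitaryGroup.rationalPairToAdelic (Fp L) L (IsCMField.complexConj L) N M (Matrix.diagonal dV) (Matrix.diagonal dW) γ)) *
        Matrix.fromBlocks 1 0 1 1 =
      Matrix.fromBlocks 1 0 (-((2 : AdeleRing (𝓞 L) L) • Matrix.diagonal (fun i => algebraMap L (AdeleRing (𝓞 L) L) (χ i))))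
        (1 - (2 : AdeleRing (𝓞 L) L) • Matrix.diagonal (fun i => algebraMap L (AdeleRing (𝓞 L) L) (χ i))) := by
  rw [frame_iotaGG_one, UnitaryGroup.coe_rationalPairToAdelic, reindex_signInvolution L e χ hγ, sub_sub_cancel_left]

/-! ## §3 Rational Levi elements with prescribed frame blocks -/

/-- **a rational Siegel element with prescribed `Δ`-block**: for `a₀ ∈ GL_n(L)` there is `m ∈ P_Δ(L⁺)` (rational and Siegel) whose frame is
`(a₀ ⊗ 1, b; 0, d)` — the Cayley–Levi element `m(a₀ ⊗ 1)` of ★ `exists_levi` (rational by ★ `mem_ratH_of_blk_eq_levi_map`, frame by `frame_levi`).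
[cite: HarrisKudlaSweet1996, §1 (1.11)] [cite: GelbartPiatetskishapiroRallis1987, Part A §1] -/
theorem exists_rat_siegel_frame₁₁ (hdV0 : ∀ i, dV i ≠ 0) (hdW0 : ∀ i, dW i ≠ 0) (a₀ : GL (Fin n) L) :
    ∃ m : HA L e dV hdV dW hdW, m ∈ ratH L e dV hdV dW hdW ∧ IsSiegelDelta L e dV hdV dW hdW m ∧
      ∃ b d : Matrix (Fin n) (Fin n) (AdeleRing (𝓞 L) L),
        Matrix.fromBlocks (1 : Matrix (Fin n) (Fin n) (AdeleRing (𝓞 L) L)) 0 (-1) 1 * blk L e dV hdV dW hdW m * Matrix.fromBlocks 1 0 1 1 =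
          Matrix.fromBlocks ((a₀ : Matrix (Fin n) (Fin n) L).map (algebraMap L (AdeleRing (𝓞 L) L))) b 0 d := by
  obtain ⟨m, hm⟩ := exists_levi L e dV hdV dW hdW hdV0 hdW0 (Matrix.GeneralLinearGroup.map (algebraMap L (AdeleRing (𝓞 L) L)) a₀)
  refine ⟨m, mem_ratH_of_blk_eq_levi_map L e dV hdV dW hdW hdV0 hdW0 a₀ hm, isSiegelDelta_of_blk_eq_levi L e dV hdV dW hdW hm, ?_⟩
  rw [hm, frame_levi]
  exact ⟨_, _, rfl⟩

/-- **a rational Siegel element with prescribed co-`Δ`-block**: for `d₀ ∈ GL_n(L)` there is `m ∈ P_Δ(L⁺)` whose frame is `(a, b; 0, d₀ ⊗ 1)` —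
the Cayley–Levi element of `a₀ := (T_L⁻¹ σ(d₀)ᵀ T_L)⁻¹`, whose co-block `T⁻¹ σ(a₀⁻¹)ᵀ T = T⁻¹ (T d₀ T⁻¹) T = d₀`.
[cite: HarrisKudlaSweet1996, §1 (1.11)] [cite: GelbartPiatetskishapiroRallis1987, Part A §1] -/
theorem exists_rat_siegel_frame₂₂ (hdV0 : ∀ i, dV i ≠ 0) (hdW0 : ∀ i, dW i ≠ 0) (d₀ : GL (Fin n) L) :
    ∃ m : HA L e dV hdV dW hdW, m ∈ ratH L e dV hdV dW hdW ∧ IsSiegelDelta L e dV hdV dW hdW m ∧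
      ∃ a b : Matrix (Fin n) (Fin n) (AdeleRing (𝓞 L) L),
        Matrix.fromBlocks (1 : Matrix (Fin n) (Fin n) (AdeleRing (𝓞 L) L)) 0 (-1) 1 * blk L e dV hdV dW hdW m * Matrix.fromBlocks 1 0 1 1 =
          Matrix.fromBlocks a b 0 ((d₀ : Matrix (Fin n) (Fin n) L).map (algebraMap L (AdeleRing (𝓞 L) L))) := by
  obtain ⟨hT, hTσ, hTt, hTA⟩ := gramRL_facts L e dV hdV dW hdW hdV0 hdW0
  set c : L →+* L := ((IsCMField.complexConj L : L ≃ₐ[Fp L] L) : L →+* L) with hc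
  set TL : Matrix (Fin n) (Fin n) L := (gramR L e dV hdV dW hdW).map (algebraMap (Fp L) L) with hTL
  have hσ : ∀ x, c (c x) = x := fun x => IsCMField.complexConj_apply_apply L x
  have hfc : ∀ x, algebraMap L (AdeleRing (𝓞 L) L) (c x) = conjAdele (Fp L) L (IsCMField.complexConj L) (algebraMap L (AdeleRing (𝓞 L) L) x) :=
    fun x => algebraMap_conj (Fp L) L _ x
  -- `a₀' := T⁻¹ σ(d₀)ᵀ T`, invertible with inverse `T⁻¹ σ(d₀⁻¹)ᵀ T`
  have hd'd : ((d₀⁻¹ : GL (Fin n) L) : Matrix (Fin n) (Fin n) L) * d₀ = 1 := by rw [← Units.val_mul, inv_mul_cancel, Units.val_one]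
  have hdd' : (d₀ : Matrix (Fin n) (Fin n) L) * (d₀⁻¹ : GL (Fin n) L) = 1 := by rw [← Units.val_mul, mul_inv_cancel, Units.val_one]
  have h1 : TL⁻¹ * ((d₀ : Matrix (Fin n) (Fin n) L).map c)ᵀ * TL * (TL⁻¹ * (((d₀⁻¹ : GL (Fin n) L) : Matrix (Fin n) (Fin n) L).map c)ᵀ * TL) = 1 := by
    rw [leviD_mul hT, hd'd, leviD_one hT]
  have h2 : TL⁻¹ * (((d₀⁻¹ : GL (Fin n) L) : Matrix (Fin n) (Fin n) L).map c)ᵀ * TL * (TL⁻¹ * ((d₀ : Matrix (Fin n) (Fin n) L).map c)ᵀ * TL) = 1 := by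
    rw [leviD_mul hT, hdd', leviD_one hT]
  set a₀ : GL (Fin n) L := ⟨_, _, h2, h1⟩ with ha₀
  obtain ⟨m, hm⟩ := exists_levi L e dV hdV dW hdW hdV0 hdW0 (Matrix.GeneralLinearGroup.map (algebraMap L (AdeleRing (𝓞 L) L)) a₀)
  refine ⟨m, mem_ratH_of_blk_eq_levi_map L e dV hdV dW hdW hdV0 hdW0 a₀ hm, isSiegelDelta_of_blk_eq_levi L e dV hdV dW hdW hm, ?_⟩
  -- the co-block of `m(a₀ ⊗ 1)` is `T⁻¹ σ((a₀ ⊗ 1)⁻¹)ᵀ T = (T_L⁻¹ σ(a₀⁻¹)ᵀ T_L) ⊗ 1 = d₀ ⊗ 1`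
  have hD : ((gramR L e dV hdV dW hdW).map ((algebraMap L (AdeleRing (𝓞 L) L)).comp (algebraMap (Fp L) L)))⁻¹ *
        ((((Matrix.GeneralLinearGroup.map (algebraMap L (AdeleRing (𝓞 L) L)) a₀)⁻¹ : GL (Fin n) (AdeleRing (𝓞 L) L)) :
            Matrix (Fin n) (Fin n) (AdeleRing (𝓞 L) L)).map (conjAdele (Fp L) L (IsCMField.complexConj L)))ᵀ *
        (gramR L e dV hdV dW hdW).map ((algebraMap L (AdeleRing (𝓞 L) L)).comp (algebraMap (Fp L) L)) =
      (d₀ : Matrix (Fin n) (Fin n) L).map (algebraMap L (AdeleRing (𝓞 L) L)) := by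
    have hinv : (((Matrix.GeneralLinearGroup.map (algebraMap L (AdeleRing (𝓞 L) L)) a₀)⁻¹ : GL (Fin n) (AdeleRing (𝓞 L) L)) :
        Matrix (Fin n) (Fin n) (AdeleRing (𝓞 L) L)) = (TL⁻¹ * ((d₀ : Matrix (Fin n) (Fin n) L).map c)ᵀ * TL).map (algebraMap L (AdeleRing (𝓞 L) L)) := by
      rw [← map_inv]; rfl
    rw [hinv, ← hTA, ← map_nonsing_inv_of_isUnit _ hT, ← map_cstar _ hfc, ← Matrix.map_mul, ← Matrix.map_mul, hTL,
      leviD_leviD hT hTσ hTt hσ]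
  rw [hm, frame_levi, hD]
  exact ⟨_, _, rfl⟩

end Doubled

end Summit.HodgeConjecture.HodgeConjecture.Cruxes.HLiu418.K2LiuSiegelDoubledRationalFrames

end
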